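import Mathlib
import HarnessLib
import Literature.Computability.AlgebraicComplexity.PatternExpressions
import Summits.ValiantsHypothesis.ValiantsHypothesis.Theorems.MonotoneRestorationMonotoneRestorationQPZetaPatterns
import Summits.ValiantsHypothesis.ValiantsHypothesis.Theorems.MonotoneRestorationOrbitCompressionQPOneRowFromFamily
import Summits.ValiantsHypothesis.ValiantsHypothesis.Theorems.MonotoneRestorationOrbitCompressionQPOneRowGadget
import Summits.ValiantsHypothesis.ValiantsHypothesis.Theorems.MonotoneRestorationOrbitCompressionQPTwoLevel
import Summits.ValiantsHypothesis.ValiantsHypothesis.Theorems.MonotoneRestorationOrbitCompressionQPEntrySymmetric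
import Summits.ValiantsHypothesis.ValiantsHypothesis.Theorems.MonotoneRestorationOrbitCompressionQPMultiRowSocket

/-!
# Route MonotoneRestoration — aside `OrbitCompressionQP` (stmt-ValiantsHypothesis-18332): the strata of this
# line IN THE CRUX'S OWN CURRENCY — square-symmetric circuits of quasi-polynomial SIZE

Composition of this hand's strata of `stub_narrowExpressionCompression` (namespace `FormulaSubstitution`) with the
tree's engine THEOREM ζ-P (`Theorems.qpSymmetric_patternExpr`: narrow expressions of quasi-polynomial length ⇒
square-symmetric circuits of quasi-polynomial size), exactly as the registered composition
`OrbitCompressionQP_of` does for the whole stub.  The aside `OrbitCompressionQP` therefore HOLDS on each stratum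
— in fact without its orbit hypothesis:

* ★★ `orbitCompressionQP_oneRow` — the crux restricted to one-row families `f_n = Σ_i g_n(row i)` (`g_n`
  symmetric), in the crux's exact shape;
* `qpSymmetricCircuits_oneRow_entryGadget`, `qpSymmetricCircuits_twoLevel`, `qpSymmetricCircuits_entrySymmetric`,
  `qpSymmetricCircuits_multiRow_of_representation` — quasi-polynomial-size square-symmetric circuits for the
  other strata.

Helper file (`--supports stmt-ValiantsHypothesis-18332`); def-free; nothing here is a named fact; no registered
stub is closed; the crux itself (all matrix-symmetric `VP` families with quasi-polynomial-orbit symmetric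
circuits) stays open; VP ≠ VNP is not moved.
-/

noncomputable section

open MvPolynomial

-- `Summit.ValiantsHypothesis.ValiantsHypothesis.…` is the tree's single-conjunct layout (Sub = Summit).
set_option linter.dupNamespace false

namespace Summit.ValiantsHypothesis.ValiantsHypothesis.Theorems

namespace FormulaSubstitution

open Literature.Computability.AlgebraicComplexity

/-- ★★ **`OrbitCompressionQP` on the one-row stratum, in the crux's exact shape** (the orbit hypothesis and
matrix symmetry are idle; `IsVPFamily f` is what is used, through Bläser–Jindal and `VQP_e = VQP`).
[cite: BlaserJindal2019, Thm. 4] -/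
theorem orbitCompressionQP_oneRow (g : (n : ℕ) → MvPolynomial (Fin n) ℂ)
    (hsymm : ∀ n, (g n).IsSymmetric) :
    let f : (n : ℕ) → MvPolynomial (Fin n × Fin n) ℂ := fun n =>
      ∑ i : Fin n, aeval (fun v : Fin n => (X (i, v) : MvPolynomial (Fin n × Fin n) ℂ)) (g n)
    (∀ (n : ℕ) (σ τ : Equiv.Perm (Fin n)),
        MvPolynomial.rename (fun p : Fin n × Fin n => (σ p.1, τ p.2)) (f n) = f n) →
      IsVPFamily f →
      (∃ c : ℕ, ∀ n : ℕ, ∃ (G : Type) (_ : Fintype G)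
          (C : LabelledArithCircuit ℂ (Fin n × Fin n) Unit G),
        C.IsSymmetric (Equiv.Perm (Fin n)) ∧ C.eval (C.output ()) = f n ∧
        C.orbitSize (Equiv.Perm (Fin n)) ≤ 2 ^ ((Nat.log 2 n + c) ^ c)) →
      ∃ c : ℕ, ∀ n : ℕ, ∃ (G : Type) (_ : Fintype G)
          (C : LabelledArithCircuit ℂ (Fin n × Fin n) Unit G),
        C.IsSymmetric (Equiv.Perm (Fin n)) ∧ C.eval (C.output ()) = f n ∧
        Fintype.card G ≤ 2 ^ ((Nat.log 2 n + c) ^ c) := by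
  intro f _ hVP _
  exact qpSymmetric_patternExpr f (narrowQP_oneRow_of_family_VP g hsymm hVP)

/-- **Quasi-polynomial square-symmetric circuits for the master one-row stratum** `Σ_i h_n(u_n(i, ·))`
(`h` symmetric `VQP`, `u` an equivariant `(1,1)` entry gadget). [cite: BlaserJindal2019, Thm. 4] -/
theorem qpSymmetricCircuits_oneRow_entryGadget (h : (n : ℕ) → MvPolynomial (Fin n) ℂ)
    (hsymm : ∀ n, (h n).IsSymmetric) (hh : IsVQPFamily h)
    (U : ℕ → PatternExpr ℂ 1 1) (u : (n : ℕ) → Fin n → Fin n → MvPolynomial (Fin n × Fin n) ℂ)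
    (hU : ∃ c : ℕ, ∀ n : ℕ, 1 ≤ n → (U n).length ≤ 2 ^ ((Nat.log 2 n + c) ^ c) ∧
      ∀ (ρ γ : Fin 1 → Fin n), (U n).value n ρ γ = u n (ρ 0) (γ 0)) :
    ∃ c : ℕ, ∀ n : ℕ, ∃ (G : Type) (_ : Fintype G)
        (C : LabelledArithCircuit ℂ (Fin n × Fin n) Unit G),
      C.IsSymmetric (Equiv.Perm (Fin n)) ∧
      C.eval (C.output ()) = ∑ i : Fin n, aeval (u n i) (h n) ∧
      Fintype.card G ≤ 2 ^ ((Nat.log 2 n + c) ^ c) :=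
  qpSymmetric_patternExpr _ (narrowQP_oneRow_entryGadget h hsymm hh U u hU)

/-- **Quasi-polynomial square-symmetric circuits for two-level aggregation** `H_n(g_n(row i))_i`.
[cite: BlaserJindal2019, Thm. 4] -/
theorem qpSymmetricCircuits_twoLevel (H g : (n : ℕ) → MvPolynomial (Fin n) ℂ)
    (hHsymm : ∀ n, (H n).IsSymmetric) (hH : IsVQPFamily H)
    (hgsymm : ∀ n, (g n).IsSymmetric) (hg : IsVQPFamily g) :
    ∃ c : ℕ, ∀ n : ℕ, ∃ (G : Type) (_ : Fintype G)
        (C : LabelledArithCircuit ℂ (Fin n × Fin n) Unit G),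
      C.IsSymmetric (Equiv.Perm (Fin n)) ∧
      C.eval (C.output ()) = aeval (fun i : Fin n =>
        aeval (fun v : Fin n => (X (i, v) : MvPolynomial (Fin n × Fin n) ℂ)) (g n)) (H n) ∧
      Fintype.card G ≤ 2 ^ ((Nat.log 2 n + c) ^ c) :=
  qpSymmetric_patternExpr _ (narrowQP_twoLevel H g hHsymm hH hgsymm hg)

/-- **Quasi-polynomial square-symmetric circuits for entry-symmetric `VQP` families** (the tree's
`qpSymmetric_of_entrySymmetric` regime, re-derived through expressions). [cite: BlaserJindal2019, Thm. 4] -/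
theorem qpSymmetricCircuits_entrySymmetric (h : (n : ℕ) → MvPolynomial (Fin n × Fin n) ℂ)
    (hsymm : ∀ n, (h n).IsSymmetric) (hh : IsVQPFamily h) :
    ∃ c : ℕ, ∀ n : ℕ, ∃ (G : Type) (_ : Fintype G)
        (C : LabelledArithCircuit ℂ (Fin n × Fin n) Unit G),
      C.IsSymmetric (Equiv.Perm (Fin n)) ∧ C.eval (C.output ()) = h n ∧
      Fintype.card G ≤ 2 ^ ((Nat.log 2 n + c) ^ c) :=
  qpSymmetric_patternExpr _ (narrowQP_entrySymmetric h hsymm hh)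

/-- **Quasi-polynomial square-symmetric circuits for the `k`-row stratum from a representation** in
polarised power sums. [cite: BurgisserClausenShokrollahi1997, Thm. (21.33)] -/
theorem qpSymmetricCircuits_multiRow_of_representation (k : ℕ) {m d : ℕ → ℕ} (hd : IsPBounded d)
    (g : (n : ℕ) → MvPolynomial (Fin k × Fin n) ℂ)
    (Q : (n : ℕ) → MvPolynomial (Fin (m n)) ℂ) (hQ : IsVQPFamily Q)
    (α : (n : ℕ) → Fin (m n) → Fin k → ℕ) (hα : ∀ n j, ∑ a, α n j a ≤ d n)
    (hrep : ∀ n, aeval (fun j : Fin (m n) =>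
      ∑ v : Fin n, ∏ a : Fin k, (X (a, v) : MvPolynomial (Fin k × Fin n) ℂ) ^ α n j a) (Q n) = g n) :
    ∃ c : ℕ, ∀ n : ℕ, ∃ (G : Type) (_ : Fintype G)
        (C : LabelledArithCircuit ℂ (Fin n × Fin n) Unit G),
      C.IsSymmetric (Equiv.Perm (Fin n)) ∧
      C.eval (C.output ()) = ∑ ρ : Fin k → Fin n,
        aeval (fun av : Fin k × Fin n => (X (ρ av.1, av.2) : MvPolynomial (Fin n × Fin n) ℂ)) (g n) ∧
      Fintype.card G ≤ 2 ^ ((Nat.log 2 n + c) ^ c) :=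
  qpSymmetric_patternExpr _ (narrowQP_multiRow_of_representation k hd g Q hQ α hα hrep)

end FormulaSubstitution

end Summit.ValiantsHypothesis.ValiantsHypothesis.Theorems

end
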